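import Summits.BirchSwinnertonDyer.Rank1Residual.X11b.BDPRouteLocalKernelCoinvariants
import Summits.BirchSwinnertonDyer.Rank1Residual.X11b.BDPRouteLocalKernelAlgebra
import HarnessLib

/-!
# Class X11b, route p2: the bad-place local kernel bound `#ker r_v ≤ p^{ord_p [E(K_v) : E₀]}` on
# the constructed objects, MODULO the subgroup `E₀` of non-singular reduction (end form of gen 13)
# (cell `b2b-bsdres`, sub-cell `multr1-p2`, gen 13)

HONEST FRAMING (verbatim, cell `b2b-bsdres`): the goal of the cell is to DELETE the
COMBINATION-SHAPED residual classes for ALL analytic-rank `≤ 1` curves over `ℚ` — "full BSD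
formula for every rank `≤ 1` curve in class `C`" assembled STRICTLY from published theorems — so
that the rank-`≤ 1` remainder becomes exactly the CONSTRUCTION-SHAPED classes, which are TYPED
(missing-input Props), NOT attempted; this is not "finishing BSD". Research route `p2` for class
X11b; no claim beyond the stated class; nothing booked; X11b stays CONSTRUCTION-SHAPED. One
definition with a body (an `AddEquiv`) and theorems; no named fact; no `sorry`. Assembles
`BDPRouteLocalKernelCoinvariants.lean` (`ker r_v ↪ B_v/(γ_v − 1)B_v`) with
`BDPRouteLocalKernelAlgebra.lean` (`#B/(γ − 1)B ≤ p^{ord_p [ker(γ−1) : ker(γ−1) ⊓ M₀]}`).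

## Content (Greenberg, LNM 1716, Lemma 3.3 at a bad `v ∤ p`: `#ker r_v = c_v^{(p)}`)

Let `E/K` be an elliptic curve over a number field, `κ` a `ℤ_p`-extension (`K_∞ = K̄^{ker κ}`),
`v` a finite place with decomposition group `D_v ≤ Γ_K` (`GreenbergSelmer.decomp`), `γ_v ∈ D_v` a
topological generator modulo `D_v ⊓ ker κ` (`exists_mem_decomp_generate`). Write
`M = E(K̄)^{ker κ ⊓ D_v}` (the algebraic points of `E(K_{∞,w})`, `FixedPoints.addSubgroup`) and
`φ = γ_v − 1` on it (`decompSubOne κ (geomPoints E) γ_v`).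

* `decompSubOne_eq_zero_iff` — `ker φ = E(K̄)^{D_v}` (the algebraic points of `E(K_v)`): a point
  fixed by `ker κ ⊓ D_v` and by `γ_v` is fixed by `D_v` (open stabiliser + topological generation).
* `fixedPrimaryEquiv` — `B_v = E[p^∞]^{ker κ ⊓ D_v}` IS the `p`-primary component of `M`, compatibly
  with `γ_v − 1`.
* **`natCard_localKer_le_pow_padicValNat_relIndex`** — for every `φ`-stable subgroup `M₀ ≤ M` of
  finite index such that `φ` maps `M[p^∞] ⊓ M₀` onto itself:
  `ker r_v = localKer (ker κ) E[p^∞] v` is finite and `#ker r_v ≤ p ^ ord_p [ker φ : ker φ ⊓ M₀]`.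
  INTENDED `M₀ = E₀(K_{∞,w})^{alg}` (points of non-singular reduction): it is `γ_v`-stable, of finite
  index (Kodaira–Néron over `K_v^{nr} ⊇ K_{∞,w}`), `(γ_v − 1)E₀(K_{∞,w})[p^∞] = E₀(K_{∞,w})[p^∞]`
  (`≅ Ẽ_ns(k_w)[p^∞]`, divisible with finite `γ_v`-kernel), and `[E(K_v)^{alg} : E₀(K_v)^{alg}] =
  [E(K_v) : E₀(K_v)] = c_v` (density of `K̄ ∩ K_v` in `K_v`, `E₀(K_v)` open) — these four GEOMETRIC
  facts are what remains of input (c) of route p2's (CTL≤)ᵗ (`BDPRouteControlSnake`); they are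
  hypotheses here, on an abstract `M₀`.

CONDITIONAL use only; nothing booked; reach and labels unchanged.

References: [GreenbergLNM1716] §3, Lemma 3.3 and its proof (p. 87), §4 proof of Thm. 4.1;
[SilvermanAEC2009] VII.2.1, VII.6.1–6.2 (`E₀`, `c_v`, Kodaira–Néron).
-/

noncomputable section

open scoped Classical

open NumberField IsDedekindDomain Field
open Literature.NumberTheory.EllipticCurves Literature.NumberTheory.EllipticCurves.GreenbergSelmer
open Literature.NumberTheory.GaloisRepresentations Literature.NumberTheory.EllipticCurves.ResKernel

universe u

namespace Summit.BirchSwinnertonDyer.Rank1Residual.X11b.AcSelmer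

variable {K : Type u} [Field K] [NumberField K] (W : WeierstrassCurve K) {p : ℕ} [Fact p.Prime]
  (κ : ZpExtension K p) {v : HeightOneSpectrum (𝓞 K)}

/-- **`ker (γ_v − 1) = E(K̄)^{D_v}` on `E(K̄)^{ker κ ⊓ D_v}`**: a point fixed by `ker κ ⊓ D_v` and by
a `γ_v ∈ D_v` generating `D_v` topologically modulo `D_v ⊓ ker κ` is fixed by all of `D_v` (its
stabiliser is open, `WeierstrassCurve.isOpen_stabilizer_point_holds`). Greenberg: "the kernel of
`γ_v − 1` … is `E(F_v)_{p}`" (p. 87). [cite: GreenbergLNM1716, §3 Lemma 3.3 (proof, p. 87)] -/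
theorem decompSubOne_eq_zero_iff {g : ↥((⊤ : Subgroup (absoluteGaloisGroup K)) ⊓ decomp v)}
    (hgen : ∀ U : Subgroup ↥((⊤ : Subgroup (absoluteGaloisGroup K)) ⊓ decomp v),
      IsOpen (U : Set ↥((⊤ : Subgroup (absoluteGaloisGroup K)) ⊓ decomp v)) →
        κ.kerSubgroup.subgroupOf ((⊤ : Subgroup (absoluteGaloisGroup K)) ⊓ decomp v) ≤ U →
          g ∈ U → U = ⊤)
    (m : FixedPoints.addSubgroup ↥(κ.kerSubgroup ⊓ decomp v) W.geomPoints) :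
    decompSubOne κ W.geomPoints (g : absoluteGaloisGroup K) (Subgroup.mem_inf.mp g.2).2 m = 0 ↔
      ∀ x ∈ decomp v, x • (m : W.geomPoints) = m := by
  constructor
  · intro h x hx
    have hgm : (g : absoluteGaloisGroup K) • (m : W.geomPoints) = m := by
      have h1 := congrArg (fun z : FixedPoints.addSubgroup ↥(κ.kerSubgroup ⊓ decomp v) W.geomPoints ↦
        (z : W.geomPoints)) h
      simp only [coe_decompSubOne_apply, ZeroMemClass.coe_zero, sub_eq_zero] at h1
      exact h1
    let U : Subgroup ↥((⊤ : Subgroup (absoluteGaloisGroup K)) ⊓ decomp v) :=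
      (MulAction.stabilizer (absoluteGaloisGroup K) (m : W.geomPoints)).subgroupOf _
    have hU : IsOpen (U : Set ↥((⊤ : Subgroup (absoluteGaloisGroup K)) ⊓ decomp v)) :=
      (W.isOpen_stabilizer_point_holds (m : W.geomPoints)).preimage continuous_subtype_val
    have hNU : κ.kerSubgroup.subgroupOf ((⊤ : Subgroup (absoluteGaloisGroup K)) ⊓ decomp v) ≤ U := by
      intro x hx
      rw [Subgroup.mem_subgroupOf, MulAction.mem_stabilizer_iff]
      exact m.2 ⟨(x : absoluteGaloisGroup K), Subgroup.mem_inf.mpr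
        ⟨Subgroup.mem_subgroupOf.mp hx, (Subgroup.mem_inf.mp x.2).2⟩⟩
    have hgU : g ∈ U := by
      rw [Subgroup.mem_subgroupOf, MulAction.mem_stabilizer_iff]
      exact hgm
    have htop := hgen U hU hNU hgU
    have hxU : (⟨x, Subgroup.mem_inf.mpr ⟨Subgroup.mem_top x, hx⟩⟩ :
        ↥((⊤ : Subgroup (absoluteGaloisGroup K)) ⊓ decomp v)) ∈ U := by
      rw [htop]; exact Subgroup.mem_top _
    rw [Subgroup.mem_subgroupOf, MulAction.mem_stabilizer_iff] at hxU
    exact hxU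
  · intro h
    apply Subtype.ext
    rw [coe_decompSubOne_apply, ZeroMemClass.coe_zero, sub_eq_zero]
    exact h _ (Subgroup.mem_inf.mp g.2).2

/-- **`B_v = E[p^∞]^{ker κ ⊓ D_v}` is the `p`-primary component of `E(K̄)^{ker κ ⊓ D_v}`** (same
points: `p`-power torsion points fixed by `ker κ ⊓ D_v`). [folklore] -/
def fixedPrimaryEquiv :
    FixedPoints.addSubgroup ↥(κ.kerSubgroup ⊓ decomp v) (W.geomPrimaryTorsion p) ≃+
      AddCommGroup.primaryComponent
        ↥(FixedPoints.addSubgroup ↥(κ.kerSubgroup ⊓ decomp v) W.geomPoints) p where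
  toFun b := ⟨⟨((b : W.geomPrimaryTorsion p) : W.geomPoints), fun x ↦ by
      have h := congrArg (fun z : W.geomPrimaryTorsion p ↦ (z : W.geomPoints)) (b.2 x)
      simpa only [Subgroup.smul_def, primaryComponent.coe_smul] using h⟩, by
      obtain ⟨k, hk⟩ := (AddCommGroup.mem_primaryComponent (G := W.geomPoints)).mp
        (b : W.geomPrimaryTorsion p).2
      exact (AddCommGroup.mem_primaryComponent).mpr ⟨k, Subtype.ext (by
        rw [AddSubgroupClass.coe_nsmul, ZeroMemClass.coe_zero]; exact hk)⟩⟩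
  invFun m := ⟨⟨((m : FixedPoints.addSubgroup ↥(κ.kerSubgroup ⊓ decomp v) W.geomPoints) :
      W.geomPoints), by
      obtain ⟨k, hk⟩ := (AddCommGroup.mem_primaryComponent).mp m.2
      exact (AddCommGroup.mem_primaryComponent).mpr ⟨k, by
        have h := congrArg (fun z : FixedPoints.addSubgroup ↥(κ.kerSubgroup ⊓ decomp v)
          W.geomPoints ↦ (z : W.geomPoints)) hk
        simpa only [AddSubgroupClass.coe_nsmul, ZeroMemClass.coe_zero] using h⟩⟩, fun x ↦
      Subtype.ext (by
        rw [Subgroup.smul_def, primaryComponent.coe_smul]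
        exact (m : FixedPoints.addSubgroup ↥(κ.kerSubgroup ⊓ decomp v) W.geomPoints).2 x)⟩
  left_inv b := rfl
  right_inv m := rfl
  map_add' a b := rfl

/-- Unfolding `fixedPrimaryEquiv` on underlying points. [folklore] -/
@[simp] theorem coe_coe_fixedPrimaryEquiv
    (b : FixedPoints.addSubgroup ↥(κ.kerSubgroup ⊓ decomp v) (W.geomPrimaryTorsion p)) :
    (((fixedPrimaryEquiv W κ b : AddCommGroup.primaryComponent
        ↥(FixedPoints.addSubgroup ↥(κ.kerSubgroup ⊓ decomp v) W.geomPoints) p) :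
        FixedPoints.addSubgroup ↥(κ.kerSubgroup ⊓ decomp v) W.geomPoints) : W.geomPoints) =
      ((b : W.geomPrimaryTorsion p) : W.geomPoints) := rfl

/-- **Greenberg's Lemma 3.3 at a bad place, modulo the subgroup of non-singular reduction.** For an
elliptic curve `E` over a number field `K`, a `ℤ_p`-extension `κ`, a finite place `v`, and
`γ_v ∈ D_v` generating `D_v` topologically modulo `D_v ⊓ ker κ`: let `M = E(K̄)^{ker κ ⊓ D_v}` and
`φ = γ_v − 1` on `M`. For every `φ`-stable subgroup `M₀ ≤ M` of finite index such that `φ` maps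
`M[p^∞] ⊓ M₀` onto itself, the local kernel `ker r_v = ker (H¹(D_v, E[p^∞]) → H¹(D_v ⊓ ker κ, E[p^∞]))`
is finite and `#ker r_v ≤ p ^ ord_p [ker φ : ker φ ⊓ M₀]` (`ker φ = E(K̄)^{D_v}`,
`decompSubOne_eq_zero_iff`). With `M₀ = E₀(K_{∞,w})^{alg}` this is `#ker r_v ≤ c_v^{(p)}`; the
properties of `E₀` are hypotheses here. [cite: GreenbergLNM1716, §3 Lemma 3.3 (p. 87)]
[cite: SilvermanAEC2009, §VII.6 (Thm. VII.6.1, `E(K)/E₀(K)` finite)] -/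
theorem natCard_localKer_le_pow_padicValNat_relIndex
    {g : ↥((⊤ : Subgroup (absoluteGaloisGroup K)) ⊓ decomp v)}
    (hgen : ∀ U : Subgroup ↥((⊤ : Subgroup (absoluteGaloisGroup K)) ⊓ decomp v),
      IsOpen (U : Set ↥((⊤ : Subgroup (absoluteGaloisGroup K)) ⊓ decomp v)) →
        κ.kerSubgroup.subgroupOf ((⊤ : Subgroup (absoluteGaloisGroup K)) ⊓ decomp v) ≤ U →
          g ∈ U → U = ⊤)
    (M₀ : AddSubgroup ↥(FixedPoints.addSubgroup ↥(κ.kerSubgroup ⊓ decomp v) W.geomPoints))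
    [M₀.FiniteIndex]
    (hM₀ : ∀ x ∈ M₀, decompSubOne κ W.geomPoints (g : absoluteGaloisGroup K)
      (Subgroup.mem_inf.mp g.2).2 x ∈ M₀)
    (hsurj : ∀ b ∈ AddCommGroup.primaryComponent
        ↥(FixedPoints.addSubgroup ↥(κ.kerSubgroup ⊓ decomp v) W.geomPoints) p, b ∈ M₀ →
      ∃ b' ∈ AddCommGroup.primaryComponent
          ↥(FixedPoints.addSubgroup ↥(κ.kerSubgroup ⊓ decomp v) W.geomPoints) p,
        b' ∈ M₀ ∧ decompSubOne κ W.geomPoints (g : absoluteGaloisGroup K)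
          (Subgroup.mem_inf.mp g.2).2 b' = b) :
    Finite (localKer κ.kerSubgroup (W.geomPrimaryTorsion p) v) ∧
      Nat.card (localKer κ.kerSubgroup (W.geomPrimaryTorsion p) v) ≤
        p ^ padicValNat p (M₀.relIndex (decompSubOne κ W.geomPoints (g : absoluteGaloisGroup K)
          (Subgroup.mem_inf.mp g.2).2).ker) := by
  have hgD : (g : absoluteGaloisGroup K) ∈ decomp v := (Subgroup.mem_inf.mp g.2).2
  -- notation: `M = E(K̄)^{ker κ ⊓ D_v}`, `φ = γ_v − 1`, `B = M[p^∞]`, `fB = φ|_B`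
  set φ := decompSubOne κ W.geomPoints (g : absoluteGaloisGroup K) hgD with hφ
  let B := AddCommGroup.primaryComponent
    ↥(FixedPoints.addSubgroup ↥(κ.kerSubgroup ⊓ decomp v) W.geomPoints) p
  let fB : B →+ B := (φ.comp B.subtype).codRestrict B
    fun b ↦ PrimaryCoinvariants.map_mem_primaryComponent p φ b.2
  have hfB : ∀ b : B, (fB b : FixedPoints.addSubgroup ↥(κ.kerSubgroup ⊓ decomp v) W.geomPoints) =
      φ b := fun _ ↦ rfl
  -- (1) the algebra: `#B/φ(B) ≤ p ^ ord_p [ker φ : ker φ ⊓ M₀]`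
  obtain ⟨hfinQ, hcardQ⟩ :=
    TamagawaCoinvariants.natCard_primaryComponent_quotient_range_le p φ M₀ hM₀ fB hfB hsurj
  haveI := hfinQ
  -- (2) `B_v/(γ_v − 1)B_v ≅ B/φ(B)` along `fixedPrimaryEquiv`
  let e := fixedPrimaryEquiv W κ (v := v)
  have he : AddSubgroup.map (e : _ →+ B)
      (decompSubOne κ (W.geomPrimaryTorsion p) (g : absoluteGaloisGroup K) hgD).range = fB.range := by
    ext b
    constructor
    · rintro ⟨x, ⟨y, rfl⟩, rfl⟩
      exact ⟨e y, Subtype.ext (Subtype.ext rfl)⟩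
    · rintro ⟨y, rfl⟩
      exact ⟨decompSubOne κ (W.geomPrimaryTorsion p) (g : absoluteGaloisGroup K) hgD (e.symm y),
        ⟨e.symm y, rfl⟩, Subtype.ext (Subtype.ext rfl)⟩
  let eq : FixedPoints.addSubgroup ↥(κ.kerSubgroup ⊓ decomp v) (W.geomPrimaryTorsion p) ⧸
      (decompSubOne κ (W.geomPrimaryTorsion p) (g : absoluteGaloisGroup K) hgD).range ≃+
        B ⧸ fB.range :=
    QuotientAddGroup.congr _ _ e he
  haveI : Finite (FixedPoints.addSubgroup ↥(κ.kerSubgroup ⊓ decomp v) (W.geomPrimaryTorsion p) ⧸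
      (decompSubOne κ (W.geomPrimaryTorsion p) (g : absoluteGaloisGroup K) hgD).range) :=
    Finite.of_equiv _ eq.toEquiv.symm
  have hcard : Nat.card (FixedPoints.addSubgroup ↥(κ.kerSubgroup ⊓ decomp v)
      (W.geomPrimaryTorsion p) ⧸
        (decompSubOne κ (W.geomPrimaryTorsion p) (g : absoluteGaloisGroup K) hgD).range) =
      Nat.card (B ⧸ fB.range) := Nat.card_congr eq.toEquiv
  -- (3) `ker r_v ↪ B_v/(γ_v − 1)B_v`
  obtain ⟨hfin, hle⟩ :=
    finite_localKer_and_natCard_le κ (W.continuous_smul_geomPrimaryTorsion p) hgen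
  exact ⟨hfin, hle.trans (hcard.le.trans hcardQ)⟩

/-- **Existential form**: there is `γ_v ∈ D_v` such that, with `M = E(K̄)^{ker κ ⊓ D_v}` and
`φ = γ_v − 1` (whose kernel is `E(K̄)^{D_v}`), for every `φ`-stable finite-index `M₀ ≤ M` on whose
`p`-primary part `φ` is onto, `#ker r_v ≤ p ^ ord_p [ker φ : ker φ ⊓ M₀]`.
[cite: GreenbergLNM1716, §3 Lemma 3.3 (p. 87)] -/
theorem exists_generator_natCard_localKer_le :
    ∃ (g : absoluteGaloisGroup K) (hg : g ∈ decomp v),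
      (∀ m : FixedPoints.addSubgroup ↥(κ.kerSubgroup ⊓ decomp v) W.geomPoints,
          decompSubOne κ W.geomPoints g hg m = 0 ↔ ∀ x ∈ decomp v, x • (m : W.geomPoints) = m) ∧
      ∀ (M₀ : AddSubgroup ↥(FixedPoints.addSubgroup ↥(κ.kerSubgroup ⊓ decomp v) W.geomPoints))
        [M₀.FiniteIndex],
        (∀ x ∈ M₀, decompSubOne κ W.geomPoints g hg x ∈ M₀) →
        (∀ b ∈ AddCommGroup.primaryComponent
            ↥(FixedPoints.addSubgroup ↥(κ.kerSubgroup ⊓ decomp v) W.geomPoints) p, b ∈ M₀ →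
          ∃ b' ∈ AddCommGroup.primaryComponent
              ↥(FixedPoints.addSubgroup ↥(κ.kerSubgroup ⊓ decomp v) W.geomPoints) p,
            b' ∈ M₀ ∧ decompSubOne κ W.geomPoints g hg b' = b) →
        Finite (localKer κ.kerSubgroup (W.geomPrimaryTorsion p) v) ∧
          Nat.card (localKer κ.kerSubgroup (W.geomPrimaryTorsion p) v) ≤
            p ^ padicValNat p (M₀.relIndex (decompSubOne κ W.geomPoints g hg).ker) := by
  obtain ⟨g, hgen⟩ := exists_mem_decomp_generate κ v
  exact ⟨(g : absoluteGaloisGroup K), (Subgroup.mem_inf.mp g.2).2,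
    decompSubOne_eq_zero_iff W κ hgen,
    fun M₀ _ hM₀ hsurj ↦ natCard_localKer_le_pow_padicValNat_relIndex W κ hgen M₀ hM₀ hsurj⟩

end Summit.BirchSwinnertonDyer.Rank1Residual.X11b.AcSelmer

/-! ## Interfaces for the counting snake lemma: away descent from `ker r_v = 0` -/

namespace Summit.BirchSwinnertonDyer.Rank1Residual.X11b.AcSelmer

section Interface

-- `K : Type`, as in `BDPRouteControlSnake` (the snake lemma lives in universe `0`).
variable {K : Type} [Field K] [NumberField K] {W : WeierstrassCurve K} {p : ℕ} [Fact p.Prime]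
  {κ : ZpExtension K p}

/-- **Away descent at `v` from `ker r_v = 0`.** If `localKer (ker κ) M v = ⊥` then every class of
`A = res⁻¹(Sel_𝔭^Σ(K_∞, M))` satisfies the away condition at `v` over `K` (its localisation lies in
`ker r_v`). This turns the good-place statement `ker r_v = 0` (Greenberg Lemma 3.3, good case;
`localKer_eq_bot_of_decompSubOne_surjective`) into the hypothesis `hS` of the counting snake lemma.
[cite: GreenbergLNM1716, §3 Lemma 3.3 (p. 87) and p. 90] -/
theorem mem_awayKer_of_localKer_eq_bot {S : Set (HeightOneSpectrum (𝓞 K))}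
    {𝔭 v : HeightOneSpectrum (𝓞 K)} (hv : ((p : ℕ) : 𝓞 K) ∉ v.asIdeal) (hvS : v ∉ S)
    (hbot : localKer κ.kerSubgroup (W.geomPrimaryTorsion p) v = ⊥)
    {c : W.subgroupH1 p (⊤ : Subgroup (absoluteGaloisGroup K))}
    (hc : W.resOfLe p (le_top : κ.kerSubgroup ≤ ⊤) c ∈ selmerAc W p κ 𝔭 S) :
    c ∈ awayKer ⊤ (W.geomPrimaryTorsion p) v := by
  have h := resOfLe_mem_localKer_of_mem_selmerAcPreimage
    ((mem_selmerAcPreimage_iff c).mpr hc) hv hvS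
  rw [hbot, AddSubgroup.mem_bot] at h
  exact (mem_awayKer_top_iff v c).mpr h

end Interface

end Summit.BirchSwinnertonDyer.Rank1Residual.X11b.AcSelmer

/-! ## Route p2: (CTL≤)ᵗ at a datum from `ker r_v = 0` at the good places, E₀-shaped data at the
bad places, and one bound on `#Sel_𝔭(K, E[p^∞])` -/

namespace Summit.BirchSwinnertonDyer.Rank1Residual.X11b

section RouteP2

open AcSelmer WeierstrassCurve Literature.NumberTheory.EllipticCurves.Rank1Residual
  Literature.NumberTheory.QuadraticFields.Quadratic

variable {W : WeierstrassCurve ℚ} [W.IsElliptic] [W.IsGloballyMinimal] {K : Type} [Field K]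
  [NumberField K] {p : ℕ} [Fact p.Prime] {κ : ZpExtension K p} {𝔭 : HeightOneSpectrum (𝓞 K)}
  {γ : Field.absoluteGaloisGroup K} [Fact (κ.IsTopGenerator γ)] {ι : K →+* ℚ_[p]}

/-- **(CTL≤)ᵗ at a datum — gen-13 end form.** For `E/ℚ` over a totally complex `K`, `κ` with
topological generator `γ`, `𝔭` with `E(K̄)[p^∞]^{D_𝔭 ⊓ ker κ} = 0` (⇐ (iv)), and a finite set `T`
of finite places `v ∤ p`: route p2's control input `ControlUpperOnTreeAt p κ 𝔭 γ ι P` follows from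
(b) `ker r_v = 0` at every finite `v ∤ p` outside `T` [Greenberg Lemma 3.3 good case / places
split completely in `K_∞` — the sibling's items, via `localKer_eq_bot_of_decompSubOne_surjective`],
(c) at each `v ∈ T` a bound `#ker r_v ≤ p^{b v}` [from an E₀-shaped subgroup via
`natCard_localKer_le_pow_padicValNat_relIndex`: `b v = ord_p [E(K̄)^{D_v} : E(K̄)^{D_v} ⊓ E₀] = ord_p c_v`],
(d) `#Sel_𝔭(K, E[p^∞]) ≤ p^a` [Cas18 (3.2.1)+(calcul) ≤; Poitou–Tate], with
`a + Σ_{v∈T} b v ≤ ord_p #Ш(E/K)[p^∞] + 2((ord_p log_ω P − 1) − ord_p[E(K):ℤP]) + ord_p ∏_{w∣N⁺} c_w`.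
CONDITIONAL; nothing booked. [cite: Castella2018, Thm. 2.3 and its proof (arXiv:1704.06608 pp. 5–6)]
[cite: GreenbergLNM1716, §3 Lemma 3.3 (p. 87), p. 90] -/
theorem controlUpperOnTreeAt_of_localKer_eq_bot_of_bounds [IsTotallyComplex K]
    (h0 : FixedPoints.addSubgroup ↥(decomp 𝔭 ⊓ κ.kerSubgroup)
      ((W.baseChange K).geomPrimaryTorsion p) = ⊥)
    (T : Finset (HeightOneSpectrum (𝓞 K))) (hTp : ∀ v ∈ T, ((p : ℕ) : 𝓞 K) ∉ v.asIdeal)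
    (hgood : ∀ v : HeightOneSpectrum (𝓞 K), ((p : ℕ) : 𝓞 K) ∉ v.asIdeal → v ∉ T →
      localKer κ.kerSubgroup ((W.baseChange K).geomPrimaryTorsion p) v = ⊥)
    [Finite (selmerAcBase (W.baseChange K) p 𝔭 ∅)]
    (hfin : ∀ v ∈ T, Finite (localKer κ.kerSubgroup ((W.baseChange K).geomPrimaryTorsion p) v))
    {a : ℕ} (ha : Nat.card (selmerAcBase (W.baseChange K) p 𝔭 ∅) ≤ p ^ a)
    {b : HeightOneSpectrum (𝓞 K) → ℕ}
    (hb : ∀ v ∈ T,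
      Nat.card (localKer κ.kerSubgroup ((W.baseChange K).geomPrimaryTorsion p) v) ≤ p ^ b v)
    {P : (W.baseChange K).toAffine.Point}
    (hm : ((a + ∑ v ∈ T, b v : ℕ) : ℤ) ≤ (padicValNat p
        (Nat.card (AddCommGroup.primaryComponent (W.baseChange K).sha p)) : ℤ) +
      2 * ((padicLogOrd W p ι P - 1) - (padicValNat p (AddSubgroup.zmultiples P).index : ℤ)) +
        padicValNat p (tamagawaProductSplit W K)) :
    ControlUpperOnTreeAt p κ 𝔭 γ ι P :=
  controlUpperOnTreeAt_of_localKer_bounds h0 T hTp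
    (fun _ hc v hv hvS hvT ↦ mem_awayKer_of_localKer_eq_bot (W := W.baseChange K) hv hvS
      (hgood v hv hvT) hc)
    hfin ha hb hm

end RouteP2

end Summit.BirchSwinnertonDyer.Rank1Residual.X11b

end
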